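import Summits.ResolutionOfSingularities.ResolutionOfSingularities.Theorems.EquisingularLiftEquisingularLiftNatLargeCharKInputs
import Summits.ResolutionOfSingularities.ResolutionOfSingularities.Theorems.EquisingularLiftEquisingularLiftNatLargeCharSpreadDoorSmoothBase
import Summits.ResolutionOfSingularities.ResolutionOfSingularities.Theorems.EquisingularLiftEquisingularLiftNatLargeCharTie
import Summits.ResolutionOfSingularities.ResolutionOfSingularities.Theorems.EquisingularLiftEquisingularLiftNatCompleteIntersectionLiftProj
import HarnessLib

/-!
# EL♮(3) / EL♮(n), RUNG LC «large characteristic» — (i″) THE DOOR OF ONE PRIME FACTOR: for a form `P ∈ A[x₀,…,xₙ]` (`n ≥ 1`) whose image in `K[x]` is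
# PRIME, the point-wise descent door `DescDoorAt B k θ n H ι` holds over every smooth `ℤ`-algebra base `B ∋ a⁻¹` (Noetherian, flat over `A`) at every
# point `θ : B → k` for every `ι : H ⟶ ℙⁿ_k` with `range ι = V₊(P_θ)`

leafhand-res-equisingularlift-4 g0 (prover, 2026-08-31; one-generation line-first hand on stmt-ResolutionOfSingularities-20148 / -20038 / -15660, cell
`pub/decomp-res`).  Crux `EquisingularLiftNatThree` (`stmt-…-20148`; the rung is uniform in `n`, so also `stmt-…-20038`), line W4.5(b), RUNG LC (idea-2 g32
`Cruxes/EquisingularLiftNatThree/LARGE-CHAR-RUNG-idea2.md` v1.6 §(B5′); lh3's HONEST RESIDUAL (i) «doors for all `j`, irreducible `range ι` = one `V₊(Pⱼ,θ)`»).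
Pure composition of tree theorems, DEF-FREE:
* the running ideal is `𝓣 := (P)~` on `ℙⁿ_A` (✓ `projIdealSheaf`); its generic fibre is `(P_K)~` (✓ `CILift.comap_projIdealSheaf_span`, base change of the form
  ideal sheaf along `ℙⁿ_K → ℙⁿ_A`), an effective Cartier divisor with INTEGRAL zero scheme carrying the characteristic-zero word (✓ `LargeChar.exists_K_word_form`,
  ✓ `LargeChar.isIntegral_subscheme_projIdealSheaf_form`, this hand's …NatLargeCharKInputs);
* lh3's door ✓ `exists_forall_descDoorAt_of_K_word_smooth` (…NatLargeCharSpreadDoorSmoothBase) then gives `s`, `a ≠ 0` and the door over every admissible `B`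
  at every `θ`, for every `ι` TIED to `𝓣`; the tying «`range ι` = support of the pulled-back `𝓣` in every graded-lift square» is discharged by lh3's
  ✓ `support_comap_comap_projIdealSheaf_span_singleton` (…NatLargeCharTie): that support is `V₊(P_θ')`, `θ' = θ ∘ (A → B)`.

★ `exists_forall_descDoorAt_of_primeForm` — see the statement.  EL♮(3) NOT proved; EL♮ NOT proved; resolution of singularities in positive characteristic NOT proved;
nothing of [Hironaka2017] (a candidate under adjudication) is asserted or used.  [OURS · composition · standard axioms · DEF-FREE ·
`--supports stmt-ResolutionOfSingularities-20148 --as helper`, counted 0 · AI-written, weaker than expert review.] [cite: Grothendieck1966, EGA IV₃ §8–§9] (method; index only)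
-/

set_option linter.dupNamespace false -- mandated namespace `Summit.<Summit>.<Problem>` of this single-conjunct summit

noncomputable section

open CategoryTheory CategoryTheory.Limits AlgebraicGeometry TopologicalSpace Topology
open MvPolynomial
open Literature.AlgebraicGeometry.Resolution
open Literature.AlgebraicGeometry.Motives
open AlgebraicGeometry.Scheme.IdealSheafData

namespace Summit.ResolutionOfSingularities.ResolutionOfSingularities.Cruxes.EquisingularLiftNat.Sections.LargeChar

section FactorDoor

variable (A : Type) [CommRing A] [IsDomain A] [IsNoetherianRing A] (K : Type) [Field K] [CharZero K] [Algebra A K] [IsFractionRing A K] (n : ℕ)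

/-- ★ **The door of one prime factor.**  `A` a Noetherian domain with fraction field `K` of characteristic `0`, `n ≥ 1`, `P ∈ A[x₀,…,xₙ]` a form of degree
`e` whose image `P_K` in `K[x]` is PRIME.  Then there is `a ≠ 0` in `A` such that for every Noetherian flat `A`-algebra `B` which is a SMOOTH `ℤ`-algebra and in
which `a` is a unit, every field `k`, every point `θ : B →+* k` and every `ι : H ⟶ ℙⁿ_k` whose range is the hypersurface `V₊(P_θ')` of the specialised form
(`θ' = θ ∘ (A → B)`): the point-wise descent door `DescDoorAt B k θ n H ι` holds.
[cite: Grothendieck1966, EGA IV₃ §8–§9] [OURS · L1 W4.5b · RUNG LC (i″); EL♮(3) NOT proved] -/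
theorem exists_forall_descDoorAt_of_primeForm (hn : 1 ≤ n) {e : ℕ} (P : MvPolynomial (Fin (n + 1)) A) (hP : P.IsHomogeneous e)
    (hprime : Prime (MvPolynomial.map (algebraMap A K) P)) :
    ∃ a : A, a ≠ 0 ∧
      ∀ (B : Type) [CommRing B] [IsNoetherianRing B] [Algebra A B] [Module.Flat A B] [Algebra ℤ B] [Algebra.Smooth ℤ B],
        IsUnit (algebraMap A B a) →
        ∀ (k : Type) [Field k] (θ : B →+* k) (H : Scheme.{0}) (ι : H ⟶ (Literature.AlgebraicGeometry.Motives.projectiveSpace n k).left),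
          letI := MvPolynomial.gradedAlgebra (σ := Fin (n + 1)) (R := k)
          Set.range ι = {x : Proj (homogeneousSubmodule (Fin (n + 1)) k) |
              MvPolynomial.map (θ.comp (algebraMap A B)) P ∈ x.asHomogeneousIdeal} →
          DescDoorAt B k θ n H ι := by
  letI := MvPolynomial.gradedAlgebra (σ := Fin (n + 1)) (R := A)
  letI := MvPolynomial.gradedAlgebra (σ := Fin (n + 1)) (R := K)
  set G : MvPolynomial (Fin (n + 1)) K := MvPolynomial.map (algebraMap A K) P with hG
  have hGhom : G.IsHomogeneous e := hP.map _
  -- the running ideal `(P)~` on `ℙⁿ_A` and its generic fibre `(P_K)~`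
  set T : (Proj (homogeneousSubmodule (Fin (n + 1)) A)).IdealSheafData :=
    projIdealSheaf (homogeneousSubmodule (Fin (n + 1)) A)
      ⟨Ideal.span {P}, Ideal.homogeneous_span _ _ (fun g hg => by
        rw [Set.mem_singleton_iff] at hg; subst hg; exact ⟨e, hP⟩)⟩ with hT
  set jK : Proj (homogeneousSubmodule (Fin (n + 1)) K) ⟶ Proj (homogeneousSubmodule (Fin (n + 1)) A) :=
    Proj.map (ProjBaseChangeRing.mapGraded A K (Fin (n + 1))) (ProjBaseChangeRing.irrelevant_le_map A K (Fin (n + 1))) with hjK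
  have hT' : T = projIdealSheaf (homogeneousSubmodule (Fin (n + 1)) A)
      ⟨Ideal.span (Set.range fun _ : Fin 1 => P),
        isHomogeneous_span_of_forall_mem _ (fun _ : Fin 1 => P) (fun _ => e) (fun _ => hP)⟩ := by
    rw [hT]
    congr 2
    rw [Set.range_const]
  have hcomap : T.comap jK = projIdealSheaf (homogeneousSubmodule (Fin (n + 1)) K)
      ⟨Ideal.span (Set.range fun _ : Fin 1 => G),
        isHomogeneous_span_of_forall_mem _ (fun _ : Fin 1 => G) (fun _ => e) (fun _ => hGhom)⟩ := by
    rw [hT', hjK]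
    exact CILift.comap_projIdealSheaf_span (φ := ProjBaseChangeRing.mapGraded A K (Fin (n + 1)))
      (hφ' := ProjBaseChangeRing.irrelevant_le_map A K (Fin (n + 1))) (hφX := ProjBaseChangeRing.mapGraded_X A K)
      (F := fun _ : Fin 1 => P) (f := fun _ : Fin 1 => G) (d := fun _ => e) (hF := fun _ => hP) (hf := fun _ => hGhom)
      (hφF := fun _ => rfl)
  -- the K-side word and the integrality of the generic fibre
  obtain ⟨tK, hsmK, hTK⟩ := exists_K_word_form K n hn G hGhom hprime
  have hint : IsIntegral (T.comap jK).subscheme := by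
    rw [hcomap]
    exact isIntegral_subscheme_projIdealSheaf_form K n hn G hGhom hprime
  have hTK' : DescTransformOK tK (𝟙 (Proj (homogeneousSubmodule (Fin (n + 1)) K)))
      ((projIdealSheaf (homogeneousSubmodule (Fin (n + 1)) K)
          ⟨Ideal.span (Set.range fun _ : Fin 1 => G),
            isHomogeneous_span_of_forall_mem _ (fun _ : Fin 1 => G) (fun _ => e) (fun _ => hGhom)⟩).support :
          Set (Proj (homogeneousSubmodule (Fin (n + 1)) K)))
      (((T.comap jK).support : Set (Proj (homogeneousSubmodule (Fin (n + 1)) K)))) := by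
    rw [hcomap]
    exact hTK
  -- lh3's door
  obtain ⟨s, a, -, ha, hdoor⟩ := exists_forall_descDoorAt_of_K_word_smooth A K n tK T
    (𝟙 (Proj (homogeneousSubmodule (Fin (n + 1)) K))) _ hsmK hTK' hint
    (fun y hy => by rw [hcomap] at hy; simpa using hy)
  refine ⟨a, ha, fun B _ _ _ _ _ _ hunit k _ θ H ι hrange => hdoor B hunit k θ H ι ?_⟩
  intro φ hφ' hφ _
  letI := MvPolynomial.gradedAlgebra (σ := Fin (n + 1)) (R := B)
  letI := MvPolynomial.gradedAlgebra (σ := Fin (n + 1)) (R := k)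
  rw [hrange, hT, support_comap_comap_projIdealSheaf_span_singleton A B k n P hP φ hφ' (θ.comp (algebraMap A B))]
  rw [hφ, ProjBaseChangeRing.mapGraded_apply, MvPolynomial.map_map]

end FactorDoor

end Summit.ResolutionOfSingularities.ResolutionOfSingularities.Cruxes.EquisingularLiftNat.Sections.LargeChar

end
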